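import Mathlib
import HarnessLib
import Summits.HubbardSuperconductivity.HubbardSuperconductivity.Theses.JosephsonMirror

/-!
# Sketch — crux-ideate round 1, ideator 1, crux `JmCusp` (stmt-HubbardSuperconductivity-2228)

First lemmas of the two idea cards (`dedouble-zero-mode-cusp`, `galois-transport-simplicity`).
`stub_*` are NOT proved (sorry); the glue `JmCusp_of_zeroModeCusp` and `JmCusp_iff_gain_and_simple`
are kernel-checked so that the transfer target is certified to conclude the crux BY NAME.
-/

namespace Summit.HubbardSuperconductivity.HubbardSuperconductivity.Cruxes.JmCusp.SketchIdeator1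

open Summit.HubbardSuperconductivity.HubbardSuperconductivity.Theses.JosephsonMirror
open scoped Matrix

set_option linter.dupNamespace false

/-- JmCusp (i), verbatim: uniform linear Josephson gain of the window double at `(U, δ)` with
constant `a` on `(0, J₀]`. -/
def JosephsonGain (U δ a J₀ : ℝ) : Prop :=
  ∀ J ∈ Set.Ioc (0:ℝ) J₀, ∃ L₀ : ℕ, ∀ (L : ℕ) [NeZero L], Even L → L₀ ≤ L → (let ι : Type := Finset (Literature.MathematicalPhysics.QuantumLattice.Orb (Literature.MathematicalPhysics.QuantumLattice.FermionTorus 2 L)); let N : ℕ := 2 * ⌊(1 - δ) * (L : ℝ) ^ 2 / 2⌋₊; let H : Matrix ι ι ℂ := Literature.MathematicalPhysics.QuantumLattice.hubbardTorus 2 L 1 U; let μ : ℝ := (H.minEnergyOn (Literature.MathematicalPhysics.QuantumLattice.szSector N 0) - H.minEnergyOn (Literature.MathematicalPhysics.QuantumLattice.szSector (N - 2) 0)) / 2; let A : Matrix ι ι ℂ := Literature.MathematicalPhysics.QuantumLattice.hubbardTorusWith 2 L 1 U μ; let D : Matrix ι ι ℂ := ((L : ℂ))⁻¹ • Literature.MathematicalPhysics.QuantumLattice.pairField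 Literature.MathematicalPhysics.QuantumLattice.dWaveFormFactor L; let Hd : ℝ → Matrix (ι × ι) (ι × ι) ℂ := fun J => Matrix.kroneckerMap (fun a b : ℂ => a * b) A 1 + Matrix.kroneckerMap (fun a b : ℂ => a * b) 1 (Matrix.transpose A) - (J : ℂ) • (Matrix.kroneckerMap (fun a b : ℂ => a * b) D (Matrix.transpose (Matrix.conjTranspose D)) + Matrix.kroneckerMap (fun a b : ℂ => a * b) (Matrix.conjTranspose D) (Matrix.transpose D)); let good : ι × ι → Prop := fun p => ((p.1.card = N ∧ p.2.card = N) ∨ (p.1.card = N - 2 ∧ p.2.card = N - 2)) ∧ (p.1.filter (fun o => (ofLex o).2 = 0)).card = (p.1.filter (fun o => (ofLex o).2 = 1)).card ∧ (p.2.filter (fun o => (ofLex o).2 = 0)).card = (p.2.filter (fun o => (ofLex o).2 = 1)).card; let S : Submodule ℂ (ι × ι → ℂ) := ⨅ (p : ι × ι) (_ : ¬ good p), LinearMap.ker (LinearMap.proj (R := ℂ) (φ := fun _ : ι × ι => ℂ) p); let E : ℝ → ℝ := fun J => (Hd J).minEnergyOn S; a * J * (L : ℝ) ^ 2 ≤ E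 0 - E J)

/-- JmCusp (ii), verbatim: eventual simplicity of the `(N_L, S^z = 0)` ground state. -/
def Simplicity (U δ : ℝ) : Prop :=
  ∃ L₀ : ℕ, ∀ (L : ℕ), Even L → L₀ ≤ L → ∀ φ φ' : Literature.MathematicalPhysics.QuantumLattice.Fock (Literature.MathematicalPhysics.QuantumLattice.Orb (Literature.MathematicalPhysics.QuantumLattice.FermionTorus 2 L)), Literature.MathematicalPhysics.QuantumLattice.IsGroundStateInSector (Literature.MathematicalPhysics.QuantumLattice.hubbardTorus 2 L 1 U) (2 * ⌊(1 - δ) * (L : ℝ) ^ 2 / 2⌋₊) 0 φ → Literature.MathematicalPhysics.QuantumLattice.IsGroundStateInSector (Literature.MathematicalPhysics.QuantumLattice.hubbardTorus 2 L 1 U) (2 * ⌊(1 - δ) * (L : ℝ) ^ 2 / 2⌋₊) 0 φ' → ∃ c : ℂ, φ' = c • φ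

/-- The crux is literally `∃ (U δ a J₀), gain ∧ simplicity` (syntactic check). -/
theorem JmCusp_iff_gain_and_simple :
    JmCusp ↔ ∃ U : ℝ, 0 < U ∧ ∃ δ ∈ Set.Ioo (0:ℝ) (1 / 2), ∃ a : ℝ, 0 < a ∧ ∃ J₀ : ℝ, 0 < J₀ ∧
      JosephsonGain U δ a J₀ ∧ Simplicity U δ :=
  Iff.rfl

/-- TRANSFER TARGET `C⁺_def` (card `dedouble-zero-mode-cusp`): the single-layer, canonical,
number-conserving ZERO-MODE d-WAVE BCS DEFORMATION has a linear cusp — for every small `g > 0`,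
eventually in even `L`, deforming `hubbardTorus 2 L 1 U` by `-(g/L²)·Δ Δᴴ` (`Δ = pairField dWaveFormFactor L`,
an annihilator, so `Δ Δᴴ` preserves the sector) lowers the `(N_L - 2, S^z = 0)` sector ground energy by at
least `a·g·L²`. One layer, all symmetries of the layer intact, no chemical potential, no tensor packaging. -/
def ZeroModeCusp (U δ a g₀ : ℝ) : Prop :=
  ∀ g ∈ Set.Ioc (0:ℝ) g₀, ∃ L₀ : ℕ, ∀ (L : ℕ) [NeZero L], Even L → L₀ ≤ L → (let ι : Type := Finset (Literature.MathematicalPhysics.QuantumLattice.Orb (Literature.MathematicalPhysics.QuantumLattice.FermionTorus 2 L)); let N : ℕ := 2 * ⌊(1 - δ) * (L : ℝ) ^ 2 / 2⌋₊; let H : Matrix ι ι ℂ := Literature.MathematicalPhysics.QuantumLattice.hubbardTorus 2 L 1 U; let P : Matrix ι ι ℂ := Literature.MathematicalPhysics.QuantumLattice.pairField Literature.MathematicalPhysics.QuantumLattice.dWaveFormFactor L; a * g * (L : ℝ) ^ 2 ≤ H.minEnergyOn (Literature.MathematicalPhysics.QuantumLattice.szSector (N - 2) 0) - (H - ((g /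 (L : ℝ) ^ 2 : ℝ) : ℂ) • (P * Pᴴ)).minEnergyOn (Literature.MathematicalPhysics.QuantumLattice.szSector (N - 2) 0))

/-- FIRST LEMMA of card `dedouble-zero-mode-cusp` (the de-doubling inequality; provable now, M-sized,
reusing the trial-state energy identity of `Theorems/…jmPairBridgeGivesGain_proof`): the single-layer
zero-mode cusp with constant `a'` gives the Josephson gain with `a = a'²/(2(a'+32))`
(`32 ≥ ‖Δ‖²/L⁴`; trial `ψ = (χ⊗χ̄ + φ_g⊗φ̄_g)/√2`, `φ_g` the deformed ground state at
`g = J·a'/(a'+32)`, `χ = Δᴴφ_g/‖Δᴴφ_g‖`; the coherence ratio is automatic from `‖Δ‖ ≤ √32·L²`). -/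
theorem stub_dedouble (U δ a' g₀ : ℝ) (hU : 0 < U) (hδ : δ ∈ Set.Ioo (0:ℝ) (1 / 2))
    (ha : 0 < a') (hg : 0 < g₀) :
    ZeroModeCusp U δ a' g₀ → JosephsonGain U δ (a' ^ 2 / (2 * (a' + 32))) g₀ := by
  sorry

/-- GLUE (kernel-checked modulo `stub_dedouble`): the transfer target `C⁺ := ZeroModeCusp ∧ Simplicity`
at one `(U, δ)` concludes the crux `JmCusp` BY NAME. -/
theorem JmCusp_of_zeroModeCusp
    (h : ∃ U : ℝ, 0 < U ∧ ∃ δ ∈ Set.Ioo (0:ℝ) (1 / 2), ∃ a' : ℝ, 0 < a' ∧ ∃ g₀ : ℝ, 0 < g₀ ∧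
      ZeroModeCusp U δ a' g₀ ∧ Simplicity U δ) : JmCusp := by
  obtain ⟨U, hU, δ, hδ, a', ha', g₀, hg₀, hC, hS⟩ := h
  exact ⟨U, hU, δ, hδ, a' ^ 2 / (2 * (a' + 32)), by positivity, g₀, hg₀,
    stub_dedouble U δ a' g₀ hU hδ ha' hg₀ hC, hS⟩

/-- CONVERSE direction (card `dedouble-zero-mode-cusp`, the Kronecker AM–GM ceiling
`K ≤ DDᴴ⊗1 + 1⊗D̄ᴴD̄`, i.e. the first step of `JmFreeLayersNoCusp`): the Josephson gain never exceeds the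
sum of the two orderings' single-layer deformation gains in the better of the two window sectors — so nothing
is lost by de-doubling. -/
def TwoSectorCusp (U δ a J₀ : ℝ) : Prop :=
  ∀ J ∈ Set.Ioc (0:ℝ) J₀, ∃ L₀ : ℕ, ∀ (L : ℕ) [NeZero L], Even L → L₀ ≤ L → (let ι : Type := Finset (Literature.MathematicalPhysics.QuantumLattice.Orb (Literature.MathematicalPhysics.QuantumLattice.FermionTorus 2 L)); let N : ℕ := 2 * ⌊(1 - δ) * (L : ℝ) ^ 2 / 2⌋₊; let H : Matrix ι ι ℂ := Literature.MathematicalPhysics.QuantumLattice.hubbardTorus 2 L 1 U; let P : Matrix ι ι ℂ := Literature.MathematicalPhysics.QuantumLattice.pairField Literature.MathematicalPhysics.QuantumLattice.dWaveFormFactor L; let c : ℂ := ((J / (L : ℝ) ^ 2 : ℝ) : ℂ); let G : ℕ → Matrix ι ι ℂ → ℝ := fun n Q => H.minEnergyOn (Literature.MathematicalPhysics.QuantumLattice.szSector n 0) - (H - c • Q).minEnergyOn (Literature.MathematicalPhysics.QuantumLattice.szSector n 0); a * J * (L : ℝ) ^ 2 ≤ (G N (P * Pᴴ) + G N (Pᴴ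 * P)) ⊔ (G (N - 2) (P * Pᴴ) + G (N - 2) (Pᴴ * P)))

theorem stub_amgm_converse (U δ a J₀ : ℝ) (hδ : δ ∈ Set.Ioo (0:ℝ) (1 / 2)) (hJ : 0 < J₀) :
    JosephsonGain U δ a J₀ → TwoSectorCusp U δ a J₀ := by
  sorry

/-- FIRST LEMMA of card `galois-transport-simplicity` (pure algebra, provable now): for an integer
pencil `T + U·D` (the Hubbard torus: `T` = hopping with entries in `0, 1, -1`, `D` = diagonal double
occupancy), if the characteristic polynomial over `ℤ[U]` of (a symmetry block of) the pencil is squarefree,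
then at every TRANSCENDENTAL coupling `U` the specialised characteristic polynomial is squarefree, i.e. every
eigenvalue of that block — in particular its lowest — is simple. (Discriminant is a nonzero integer
polynomial in `U`; it cannot vanish at a transcendental point.) -/
theorem stub_transcendental_squarefree {n : Type} [Fintype n] [DecidableEq n]
    (T D : Matrix n n ℤ) (U : ℝ) (hU : Transcendental ℚ U)
    (hsq : Squarefree (T.map (algebraMap ℤ (Polynomial ℤ)) +
      (Polynomial.X : Polynomial ℤ) • D.map (algebraMap ℤ (Polynomial ℤ))).charpoly) :
    Squarefree (T.map (Int.castRingHom ℝ) + U • D.map (Int.castRingHom ℝ)).charpoly := by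
  sorry

end Summit.HubbardSuperconductivity.HubbardSuperconductivity.Cruxes.JmCusp.SketchIdeator1
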